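import Mathlib.Analysis.InnerProductSpace.Positive
import Mathlib.Analysis.InnerProductSpace.Projection.Basic
import Mathlib.Analysis.InnerProductSpace.Adjoint
import Mathlib.MeasureTheory.Integral.Bochner.Basic
import Mathlib.Data.EReal.Basic
import Literature.Probability.LatticeModels.ReflectionPositivity
import HarnessLib

-- provenance: harness21/H21/H21/Prelude/StatMech/TransferOperator.lean @ bc6e1d0 (interim HEAD d8f2665); M5 mechanical rewrite
/-!
# Transfer operator / Osterwalder–Schrader Hilbert space (StatMech trunk, prelude P20 / D5, R3)

The *transfer matrix* formalism of lattice statistical mechanics / Euclidean lattice field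
theory, packaged as **hypothesis structures** (outline D5, R3): we do not construct the
Osterwalder–Schrader (OS) Hilbert space by a GNS quotient (deferred to the AQFT trunk); instead

* `TransferData H` bundles, on a given complex Hilbert space `H`, a positive (hence
  self-adjoint) contraction `T` (the transfer operator `T = e^{-aH}`) and a unit *vacuum* vector
  `Ω` with `T Ω = Ω`;
* `TransferData.gapNorm D = ‖T ∘ P_{Ω^⊥}‖` is the norm of `T` restricted to the orthogonal
  complement of the vacuum line, `TransferData.HasMassGap D m :↔ 0 < m ∧ gapNorm ≤ e^{-m}`,
  and `TransferData.massGap D = -log gapNorm ∈ EReal` (`⊤` when `gapNorm = 0`);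
* `IsOSRealisation μ reflect shift m₊ ι D` says that `(H, D)` realises the OS reconstruction of
  a measure `μ` on `Ω` with time reflection `reflect`, unit time shift `shift` and positive-time
  σ-algebra `m₊`, via a map `ι` from bounded `m₊`-measurable observables to `H`:
  `⟪ι F, ι G⟫ = ∫ conj (F ∘ reflect) · G dμ`, `ι (G ∘ shift) = T (ι G)`, `ι 1 = Ω`, dense range;
* `HasTimeClustering μ reflect shift m₊ m`: exponential clustering in the time direction,
  written with the *same reflected bilinear form*, so that the clustered quantity is literally
  `⟪ι F, T^t ι G⟫ - ⟪ι F, Ω⟫ ⟪Ω, ι G⟫`;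
* sanity theorem `IsOSRealisation.hasTimeClustering_of_hasMassGap` (named fact), discharged below
  by `IsOSRealisation.hasTimeClustering_of_hasMassGap_holds` (spectral estimate on `Ω^⊥`).

Mathlib search: Mathlib has `ContinuousLinearMap.IsPositive` (includes symmetry),
`Submodule.starProjection` with the instance `Kᗮ.HasOrthogonalProjection` for `K = ℂ ∙ v` in a
complete space, `Submodule.starProjection_norm_le`; it has no transfer operator, OS
reconstruction or mass-gap notion. Nothing here duplicates Mathlib.

References: J. Glimm, A. Jaffe, *Quantum Physics: a functional integral point of view*, 2nd ed.
(1987), §6.1; K. Osterwalder, E. Seiler, *Gauge field theories on a lattice*, Ann. Phys. 110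
(1978), §2; E. Seiler, *Gauge theories as a problem of constructive QFT and statistical
mechanics*, LNP 159 (1982), Ch. 2.
-/

open MeasureTheory
open scoped InnerProductSpace

namespace Literature.Probability.LatticeModels

/-! ### Transfer data on a Hilbert space -/

section Transfer

variable (H : Type*) [NormedAddCommGroup H] [InnerProductSpace ℂ H] [CompleteSpace H]

/-- **Transfer data** on a complex Hilbert space `H`: a positive contraction `T : H →L[ℂ] H`
(the transfer operator; `ContinuousLinearMap.IsPositive` includes self-adjointness) together
with a unit vector `vacuum` fixed by `T`. This is the output of the Osterwalder–Schrader
reconstruction for a reflection-positive, translation-invariant lattice measure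
(Glimm–Jaffe 1987 §6.1, Theorem 6.1.3; Osterwalder–Seiler 1978 §2; Seiler LNP 159 Ch. 2). [cite: GlimmJaffe1987, §6.1  Theorem 6.1.3] -/
structure TransferData where
  /-- The transfer operator `T = e^{-H}` (one lattice unit of Euclidean time). -/
  T : H →L[ℂ] H
  /-- The vacuum vector `Ω`. -/
  vacuum : H
  /-- `T` is a positive operator (in particular self-adjoint). -/
  isPositive : T.IsPositive
  /-- `T` is a contraction. -/
  norm_le_one : ‖T‖ ≤ 1
  /-- The vacuum is `T`-invariant. -/
  map_vacuum : T vacuum = vacuum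
  /-- The vacuum is a unit vector. -/
  norm_vacuum : ‖vacuum‖ = 1

variable {H}

namespace TransferData

/-- The vacuum line `ℂ ∙ Ω ⊆ H` (Glimm–Jaffe 1987 §6.1). [cite: GlimmJaffe1987, §6.1] -/
def vacuumLine (D : TransferData H) : Submodule ℂ H := ℂ ∙ D.vacuum

/-- The **gap norm** `‖T ∘ P_{Ω^⊥}‖`: the operator norm of the transfer operator composed with
the orthogonal projection onto the orthogonal complement of the vacuum line. Since `T` is
self-adjoint and fixes `Ω`, this is the spectral radius of `T` on `Ω^⊥`, i.e. `e^{-massGap}`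
(Glimm–Jaffe 1987 §6.1; Seiler LNP 159 Ch. 2). [cite: GlimmJaffe1987, §6.1] -/
noncomputable def gapNorm (D : TransferData H) : ℝ :=
  ‖D.T ∘L (D.vacuumLine)ᗮ.starProjection‖

/-- The gap norm is nonnegative (it is an operator norm). [folklore] -/
theorem gapNorm_nonneg (D : TransferData H) : 0 ≤ D.gapNorm := norm_nonneg _

/-- The gap norm is at most `1`, since `T` is a contraction and orthogonal projections have norm
at most `1` (Glimm–Jaffe 1987 §6.1). [cite: GlimmJaffe1987, §6.1] -/
theorem gapNorm_le_one (D : TransferData H) : D.gapNorm ≤ 1 := by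
  unfold gapNorm
  calc ‖D.T ∘L (D.vacuumLine)ᗮ.starProjection‖
      ≤ ‖D.T‖ * ‖(D.vacuumLine)ᗮ.starProjection‖ := ContinuousLinearMap.opNorm_comp_le _ _
    _ ≤ 1 * 1 := mul_le_mul D.norm_le_one (Submodule.starProjection_norm_le _) (norm_nonneg _)
        zero_le_one
    _ = 1 := one_mul 1

/-- `D.HasMassGap m`: the transfer data has a **mass gap** at least `m > 0`, i.e.
`‖T|_{Ω^⊥}‖ ≤ e^{-m}`; equivalently `spec T ⊆ {1} ∪ [0, e^{-m}]` with `1` a simple eigenvalue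
(Glimm–Jaffe 1987 §6.1; Osterwalder–Seiler 1978 §2). [cite: GlimmJaffe1987, §6.1] -/
def HasMassGap (D : TransferData H) (m : ℝ) : Prop :=
  0 < m ∧ D.gapNorm ≤ Real.exp (-m)

/-- The **mass gap** `-log ‖T|_{Ω^⊥}‖ ∈ EReal` of the transfer data. Convention: if
`gapNorm = 0` (e.g. `H = ℂ ∙ Ω`, or `T` vanishes on `Ω^⊥`) the gap is `⊤` (set explicitly rather
than via the junk value `Real.log 0 = 0`). It is nonnegative by `gapNorm_le_one`
(Glimm–Jaffe 1987 §6.1; Seiler LNP 159 Ch. 2). [cite: GlimmJaffe1987, §6.1] -/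
noncomputable def massGap (D : TransferData H) : EReal :=
  if D.gapNorm = 0 then ⊤ else ((-Real.log D.gapNorm : ℝ) : EReal)

/-- The mass gap is nonnegative, since `gapNorm ≤ 1` (Glimm–Jaffe 1987 §6.1). [cite: GlimmJaffe1987, §6.1] -/
theorem massGap_nonneg (D : TransferData H) : 0 ≤ D.massGap := by
  unfold massGap
  split_ifs with h
  · exact le_top
  · exact EReal.coe_nonneg.mpr
      (neg_nonneg.mpr (Real.log_nonpos D.gapNorm_nonneg D.gapNorm_le_one))

/-- A mass gap `≥ m > 0` in the sense of `HasMassGap` gives `m ≤ massGap`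
(Glimm–Jaffe 1987 §6.1). [cite: GlimmJaffe1987, §6.1] -/
theorem HasMassGap.le_massGap {D : TransferData H} {m : ℝ} (h : D.HasMassGap m) :
    (m : EReal) ≤ D.massGap := by
  unfold massGap
  split_ifs with h0
  · exact le_top
  · refine EReal.coe_le_coe_iff.mpr ?_
    have hpos : 0 < D.gapNorm := lt_of_le_of_ne D.gapNorm_nonneg (Ne.symm h0)
    have := Real.log_le_log hpos h.2
    rw [Real.log_exp] at this
    linarith

end TransferData

end Transfer

/-! ### Osterwalder–Schrader realisation of a measure -/

section OS

variable {Ω : Type*} {mΩ : MeasurableSpace Ω}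

/-- `IsBoundedMeasurable m₊ F`: the observable `F : Ω → ℂ` is measurable with respect to the
sub-σ-algebra `m₊` (the *positive-time* σ-algebra) and bounded. These are the observables on
which the OS map `ι` is specified (Glimm–Jaffe 1987 §6.1; Osterwalder–Seiler 1978 §2). [cite: GlimmJaffe1987, §6.1] -/
def IsBoundedMeasurable (mpos : MeasurableSpace Ω) (F : Ω → ℂ) : Prop :=
  Measurable[mpos] F ∧ ∃ C : ℝ, ∀ ω, ‖F ω‖ ≤ C

variable {H : Type*} [NormedAddCommGroup H] [InnerProductSpace ℂ H] [CompleteSpace H]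

/-- `IsOSRealisation μ reflect shift m₊ ι D`: the Hilbert space `H` with transfer data `D` and
the map `ι : (Ω → ℂ) → H` **realise the Osterwalder–Schrader reconstruction** of the measure `μ`
with time reflection `reflect`, unit time translation `shift` and positive-time σ-algebra `m₊`:
the inner product of `H` is the reflected bilinear form `⟪ι F, ι G⟫ = ∫ conj (F (reflect ω)) G ω dμ`
on bounded `m₊`-measurable observables, `shift` preserves `m₊`-measurability and is
implemented by `T`, the constant `1` is sent to the vacuum, and the image of the bounded
`m₊`-measurable observables is dense. Only the values of `ι` on bounded `m₊`-measurable
functions matter (its values elsewhere are junk). Linearity of `ι` on these functions follows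
from `inner_eq` by polarisation and density, hence is not a field
(Glimm–Jaffe 1987 §6.1, Theorem 6.1.3; Osterwalder–Seiler 1978 §2; Seiler LNP 159 Ch. 2;
outline D5/R3: the GNS construction itself is deferred). [cite: GlimmJaffe1987, §6.1  Theorem 6.1.3] -/
structure IsOSRealisation (μ : Measure Ω) (reflect shift : Ω → Ω) (mpos : MeasurableSpace Ω)
    (ι : (Ω → ℂ) → H) (D : TransferData H) : Prop where
  /-- The inner product is the reflected (OS) bilinear form. -/
  inner_eq : ∀ F G, IsBoundedMeasurable mpos F → IsBoundedMeasurable mpos G →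
    ⟪ι F, ι G⟫_ℂ = ∫ ω, starRingEnd ℂ (F (reflect ω)) * G ω ∂μ
  /-- The time shift maps positive-time observables to positive-time observables. -/
  measurable_comp_shift : ∀ G : Ω → ℂ, Measurable[mpos] G → Measurable[mpos] (G ∘ shift)
  /-- The time shift is implemented by the transfer operator. -/
  map_shift : ∀ G, IsBoundedMeasurable mpos G → ι (G ∘ shift) = D.T (ι G)
  /-- The constant observable `1` is sent to the vacuum. -/
  map_one : ι 1 = D.vacuum
  /-- The image of the bounded positive-time observables is dense in `H`. -/
  dense : Dense (ι '' {G | IsBoundedMeasurable mpos G})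

/-- `HasTimeClustering μ reflect shift m₊ m`: **exponential clustering in the time direction**
with rate `m`, written with the reflected (OS) bilinear form: for all bounded `m₊`-measurable
`F, G` there is `C` with
`|∫ conj (F (reflect ω)) G (shift^t ω) dμ - (∫ conj (F ∘ reflect) dμ) (∫ G dμ)| ≤ C e^{-m t}`
for all `t : ℕ`. Under an OS realisation the left-hand side is
`⟪ι F, T^t ι G⟫ - ⟪ι F, Ω⟫ ⟪Ω, ι G⟫` (Glimm–Jaffe 1987 §6.1; Seiler LNP 159 Ch. 2). The constant
`C` depends on `F, G` (outline D5: volume-uniformity is not encoded here). [cite: GlimmJaffe1987, §6.1] -/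
def HasTimeClustering (μ : Measure Ω) (reflect shift : Ω → Ω) (mpos : MeasurableSpace Ω)
    (m : ℝ) : Prop :=
  ∀ F G, IsBoundedMeasurable mpos F → IsBoundedMeasurable mpos G → ∃ C : ℝ, ∀ t : ℕ,
    ‖(∫ ω, starRingEnd ℂ (F (reflect ω)) * G (shift^[t] ω) ∂μ) -
        (∫ ω, starRingEnd ℂ (F (reflect ω)) ∂μ) * ∫ ω, G ω ∂μ‖ ≤ C * Real.exp (-m * t)

/-- **Mass gap implies exponential clustering** (sanity check, one direction of
Glimm–Jaffe 1987 §6.1 / Seiler LNP 159 Ch. 2): if `(H, ι, D)` is an OS realisation of `μ` and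
`D` has a mass gap `≥ m`, then `μ` clusters exponentially in time with rate `m`. Proof sketch:
`⟪ι F, T^t ι G⟫ - ⟪ι F, Ω⟫⟪Ω, ι G⟫ = ⟪ι F, (T P_{Ω^⊥})^t ι G⟫` and `‖(T P_{Ω^⊥})^t‖ ≤ e^{-m t}`. [cite: GlimmJaffe1987, §6.1 / Seiler LNP 159 Ch. 2] -/
def IsOSRealisation.hasTimeClustering_of_hasMassGap : Prop :=
  ∀ {μ : Measure Ω} {reflect shift : Ω → Ω} {mpos : MeasurableSpace Ω} {ι : (Ω → ℂ) → H} {D : TransferData H} (hOS : IsOSRealisation (mΩ := mΩ) μ reflect shift mpos ι D) {m : ℝ} (hm : D.HasMassGap m),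
    HasTimeClustering (mΩ := mΩ) μ reflect shift mpos m

end OS

/-! ### Proof of `IsOSRealisation.hasTimeClustering_of_hasMassGap`

The standard spectral estimate behind "mass gap ⇒ exponential clustering" (Glimm–Jaffe 1987
§6.1, Theorem 6.1.3 and the remark that the decay rates of `e^{-tH}` on `(I - P_Ω) 𝓗` are the
masses, cf. §17.2): since `T` is symmetric and fixes `Ω`, it preserves `Ω^⊥`, so on `Ω^⊥` one
has `‖T^t w‖ ≤ ‖T P_{Ω^⊥}‖^t ‖w‖ = gapNorm^t ‖w‖`; writing `ι G = ⟪Ω, ι G⟫ Ω + w` gives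
`⟪ι F, T^t ι G⟫ - ⟪ι F, Ω⟫⟪Ω, ι G⟫ = ⟪ι F, T^t w⟫`, bounded by `‖ι F‖ ‖ι G‖ e^{-m t}`. -/

section Proofs

namespace TransferData

variable {H : Type*} [NormedAddCommGroup H] [InnerProductSpace ℂ H] [CompleteSpace H]

omit [CompleteSpace H] in
/-- The transfer operator maps the orthogonal complement of the vacuum line into itself: it is
symmetric and fixes the vacuum (Glimm–Jaffe 1987 §6.1, Theorem 6.1.3). [cite: GlimmJaffe1987, §6.1  Theorem 6.1.3] -/
theorem map_mem_vacuumLine_orthogonal (D : TransferData H) {w : H}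
    (hw : w ∈ (D.vacuumLine)ᗮ) : D.T w ∈ (D.vacuumLine)ᗮ := by
  rw [vacuumLine, Submodule.mem_orthogonal_singleton_iff_inner_right] at hw ⊢
  rw [← D.isPositive.inner_left_eq_inner_right, D.map_vacuum, hw]

omit [CompleteSpace H] in
/-- Powers of the transfer operator fix the vacuum. [folklore] -/
theorem pow_apply_vacuum (D : TransferData H) (t : ℕ) : (D.T ^ t) D.vacuum = D.vacuum := by
  induction t with
  | zero => simp
  | succ t ih => rw [pow_succ, mul_apply_eq_comp, D.map_vacuum, ih]

/-- On the orthogonal complement of the vacuum line the powers of the transfer operator stay in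
the complement and decay like `gapNorm ^ t`: `‖T^t w‖ ≤ ‖T P_{Ω^⊥}‖^t ‖w‖`
(Glimm–Jaffe 1987 §6.1; the decay rate of `e^{-tH}` on `(I - P_Ω) 𝓗`). [cite: GlimmJaffe1987, §6.1] -/
theorem pow_apply_mem_orthogonal_and_norm_le (D : TransferData H) {w : H}
    (hw : w ∈ (D.vacuumLine)ᗮ) (t : ℕ) :
    (D.T ^ t) w ∈ (D.vacuumLine)ᗮ ∧ ‖(D.T ^ t) w‖ ≤ D.gapNorm ^ t * ‖w‖ := by
  induction t with
  | zero => simp [hw]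
  | succ t ih =>
    obtain ⟨hmem, hnorm⟩ := ih
    rw [pow_succ', mul_apply_eq_comp]
    refine ⟨D.map_mem_vacuumLine_orthogonal hmem, ?_⟩
    have hfix : (D.vacuumLine)ᗮ.starProjection ((D.T ^ t) w) = (D.T ^ t) w :=
      Submodule.starProjection_eq_self_iff.mpr hmem
    calc ‖D.T ((D.T ^ t) w)‖
        = ‖(D.T ∘L (D.vacuumLine)ᗮ.starProjection) ((D.T ^ t) w)‖ := by
          rw [ContinuousLinearMap.comp_apply, hfix]
      _ ≤ D.gapNorm * ‖(D.T ^ t) w‖ := (D.T ∘L (D.vacuumLine)ᗮ.starProjection).le_opNorm _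
      _ ≤ D.gapNorm * (D.gapNorm ^ t * ‖w‖) := mul_le_mul_of_nonneg_left hnorm D.gapNorm_nonneg
      _ = D.gapNorm ^ (t + 1) * ‖w‖ := by ring

/-- **Spectral clustering estimate** for transfer data:
`‖⟪u, T^t v⟫ - ⟪u, Ω⟫ ⟪Ω, v⟫‖ ≤ ‖u‖ ‖v‖ gapNorm^t` for all `u v : H` and `t : ℕ`
(Glimm–Jaffe 1987 §6.1; Seiler LNP 159 Ch. 2). [cite: GlimmJaffe1987, §6.1] -/
theorem norm_inner_pow_apply_sub_le (D : TransferData H) (u v : H) (t : ℕ) :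
    ‖⟪u, (D.T ^ t) v⟫_ℂ - ⟪u, D.vacuum⟫_ℂ * ⟪D.vacuum, v⟫_ℂ‖ ≤ ‖u‖ * ‖v‖ * D.gapNorm ^ t := by
  obtain ⟨w, hw, hwle, hdec⟩ : ∃ w, w ∈ (D.vacuumLine)ᗮ ∧ ‖w‖ ≤ ‖v‖ ∧
      v = ⟪D.vacuum, v⟫_ℂ • D.vacuum + w := by
    refine ⟨(D.vacuumLine)ᗮ.starProjection v, Submodule.starProjection_apply_mem _ v,
      Submodule.norm_starProjection_apply_le _ v, ?_⟩
    have h1 := Submodule.starProjection_add_starProjection_orthogonal (K := ℂ ∙ D.vacuum) v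
    rw [Submodule.starProjection_unit_singleton (𝕜 := ℂ) D.norm_vacuum v] at h1
    exact h1.symm
  have hTv : (D.T ^ t) v = ⟪D.vacuum, v⟫_ℂ • D.vacuum + (D.T ^ t) w := by
    calc (D.T ^ t) v = (D.T ^ t) (⟪D.vacuum, v⟫_ℂ • D.vacuum + w) := by rw [← hdec]
      _ = ⟪D.vacuum, v⟫_ℂ • D.vacuum + (D.T ^ t) w := by
          rw [map_add, map_smul, D.pow_apply_vacuum]
  have hkey : ⟪u, (D.T ^ t) v⟫_ℂ - ⟪u, D.vacuum⟫_ℂ * ⟪D.vacuum, v⟫_ℂ = ⟪u, (D.T ^ t) w⟫_ℂ := by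
    rw [hTv, inner_add_right, inner_smul_right]
    ring
  obtain ⟨-, hnorm⟩ := D.pow_apply_mem_orthogonal_and_norm_le hw t
  rw [hkey]
  calc ‖⟪u, (D.T ^ t) w⟫_ℂ‖ ≤ ‖u‖ * ‖(D.T ^ t) w‖ := norm_inner_le_norm _ _
    _ ≤ ‖u‖ * (D.gapNorm ^ t * ‖w‖) := mul_le_mul_of_nonneg_left hnorm (norm_nonneg _)
    _ ≤ ‖u‖ * (D.gapNorm ^ t * ‖v‖) :=
        mul_le_mul_of_nonneg_left (mul_le_mul_of_nonneg_left hwle (pow_nonneg D.gapNorm_nonneg _))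
          (norm_nonneg _)
    _ = ‖u‖ * ‖v‖ * D.gapNorm ^ t := by ring

/-- Under a mass gap `≥ m`, the clustering estimate decays like `e^{-m t}`:
`‖⟪u, T^t v⟫ - ⟪u, Ω⟫ ⟪Ω, v⟫‖ ≤ ‖u‖ ‖v‖ e^{-m t}` (Glimm–Jaffe 1987 §6.1). [cite: GlimmJaffe1987, §6.1] -/
theorem HasMassGap.norm_inner_pow_apply_sub_le {D : TransferData H} {m : ℝ} (hm : D.HasMassGap m)
    (u v : H) (t : ℕ) :
    ‖⟪u, (D.T ^ t) v⟫_ℂ - ⟪u, D.vacuum⟫_ℂ * ⟪D.vacuum, v⟫_ℂ‖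
      ≤ ‖u‖ * ‖v‖ * Real.exp (-m * t) := by
  have hexp : D.gapNorm ^ t ≤ Real.exp (-m * t) := by
    calc D.gapNorm ^ t ≤ Real.exp (-m) ^ t := pow_le_pow_left₀ D.gapNorm_nonneg hm.2 t
      _ = Real.exp (-m * t) := by rw [← Real.exp_nat_mul]; congr 1; ring
  exact (D.norm_inner_pow_apply_sub_le u v t).trans
    (mul_le_mul_of_nonneg_left hexp (by positivity))

end TransferData

variable {Ω : Type*} {mΩ : MeasurableSpace Ω}
variable {H : Type*} [NormedAddCommGroup H] [InnerProductSpace ℂ H] [CompleteSpace H]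

/-- The constant observable `1` is bounded and measurable for every σ-algebra. [folklore] -/
theorem isBoundedMeasurable_one (mpos : MeasurableSpace Ω) :
    IsBoundedMeasurable mpos (1 : Ω → ℂ) :=
  ⟨measurable_const, 1, fun ω => by simp⟩

namespace IsOSRealisation

variable {μ : Measure Ω} {reflect shift : Ω → Ω} {mpos : MeasurableSpace Ω} {ι : (Ω → ℂ) → H}
  {D : TransferData H}

omit [CompleteSpace H] in
/-- Iterates of the time shift preserve bounded positive-time observables
(Glimm–Jaffe 1987 §6.1: `T(t) : 𝓔₊ → 𝓔₊`). [cite: GlimmJaffe1987, §6.1  Theorem 6.1.3] -/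
theorem isBoundedMeasurable_comp_iterate
    (hOS : IsOSRealisation (mΩ := mΩ) μ reflect shift mpos ι D) {G : Ω → ℂ}
    (hG : IsBoundedMeasurable mpos G) (t : ℕ) : IsBoundedMeasurable mpos (G ∘ shift^[t]) := by
  refine ⟨?_, ?_⟩
  · induction t with
    | zero => simpa using hG.1
    | succ t ih =>
      rw [Function.iterate_succ]
      exact hOS.measurable_comp_shift _ ih
  · obtain ⟨C, hC⟩ := hG.2
    exact ⟨C, fun ω => hC _⟩

omit [CompleteSpace H] in
/-- Iterates of the time shift are implemented by powers of the transfer operator: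
`ι (G ∘ shift^t) = T^t (ι G)` (Glimm–Jaffe 1987 §6.1, Theorem 6.1.3: `T(t)^∧ = e^{-tH}`,
semigroup law (i)). [cite: GlimmJaffe1987, §6.1  Theorem 6.1.3] -/
theorem map_comp_iterate
    (hOS : IsOSRealisation (mΩ := mΩ) μ reflect shift mpos ι D) {G : Ω → ℂ}
    (hG : IsBoundedMeasurable mpos G) (t : ℕ) : ι (G ∘ shift^[t]) = (D.T ^ t) (ι G) := by
  induction t with
  | zero => simp
  | succ t ih =>
    rw [Function.iterate_succ, ← Function.comp_assoc,
      hOS.map_shift _ (hOS.isBoundedMeasurable_comp_iterate hG t), ih, pow_succ',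
      mul_apply_eq_comp]

omit [CompleteSpace H] in
/-- Under an OS realisation the reflected pairing of `F` with a constant is `⟪ι F, Ω⟫`:
`∫ conj (F ∘ reflect) dμ = ⟪ι F, Ω⟫` (Glimm–Jaffe 1987 §6.1, `Ω = 1^∧`). [cite: GlimmJaffe1987, §6.1  Theorem 6.1.3] -/
theorem integral_conj_comp_reflect
    (hOS : IsOSRealisation (mΩ := mΩ) μ reflect shift mpos ι D) {F : Ω → ℂ}
    (hF : IsBoundedMeasurable mpos F) :
    ∫ ω, starRingEnd ℂ (F (reflect ω)) ∂μ = ⟪ι F, D.vacuum⟫_ℂ := by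
  rw [← hOS.map_one, hOS.inner_eq F 1 hF (isBoundedMeasurable_one mpos)]
  simp

omit [CompleteSpace H] in
/-- Under an OS realisation the expectation of `G` is `⟪Ω, ι G⟫`: `∫ G dμ = ⟪Ω, ι G⟫`
(Glimm–Jaffe 1987 §6.1, `Ω = 1^∧`). [cite: GlimmJaffe1987, §6.1  Theorem 6.1.3] -/
theorem integral_eq_inner_vacuum
    (hOS : IsOSRealisation (mΩ := mΩ) μ reflect shift mpos ι D) {G : Ω → ℂ}
    (hG : IsBoundedMeasurable mpos G) :
    ∫ ω, G ω ∂μ = ⟪D.vacuum, ι G⟫_ℂ := by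
  rw [← hOS.map_one, hOS.inner_eq 1 G (isBoundedMeasurable_one mpos) hG]
  simp

omit [CompleteSpace H] in
/-- Under an OS realisation the time-shifted reflected pairing is a matrix element of `T^t`:
`∫ conj (F (reflect ω)) G (shift^t ω) dμ = ⟪ι F, T^t ι G⟫`
(Glimm–Jaffe 1987 §6.1, (6.1.12d)). [cite: GlimmJaffe1987, §6.1  Theorem 6.1.3] -/
theorem integral_conj_comp_reflect_mul_comp_iterate
    (hOS : IsOSRealisation (mΩ := mΩ) μ reflect shift mpos ι D) {F G : Ω → ℂ}
    (hF : IsBoundedMeasurable mpos F) (hG : IsBoundedMeasurable mpos G) (t : ℕ) :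
    ∫ ω, starRingEnd ℂ (F (reflect ω)) * G (shift^[t] ω) ∂μ = ⟪ι F, (D.T ^ t) (ι G)⟫_ℂ := by
  rw [← hOS.map_comp_iterate hG t, hOS.inner_eq F _ hF (hOS.isBoundedMeasurable_comp_iterate hG t)]
  rfl

end IsOSRealisation

/-- **Mass gap implies exponential clustering** — discharge of the named fact
`IsOSRealisation.hasTimeClustering_of_hasMassGap`, with clustering constant `C = ‖ι F‖ ‖ι G‖`:
`|⟪ι F, T^t ι G⟫ - ⟪ι F, Ω⟫⟪Ω, ι G⟫| = |⟪ι F, T^t P_{Ω^⊥} ι G⟫| ≤ ‖ι F‖ ‖ι G‖ ‖T P_{Ω^⊥}‖^t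
≤ ‖ι F‖ ‖ι G‖ e^{-m t}` (Glimm–Jaffe 1987 §6.1, Theorem 6.1.3 and the spectral remark on
`e^{-tH}` restricted to `(I - P_Ω) 𝓗`; Seiler LNP 159 Ch. 2). [cite: GlimmJaffe1987, §6.1  Theorem 6.1.3] -/
theorem IsOSRealisation.hasTimeClustering_of_hasMassGap_holds :
    IsOSRealisation.hasTimeClustering_of_hasMassGap (Ω := Ω) (mΩ := mΩ) (H := H) := by
  intro μ reflect shift mpos ι D hOS m hm F G hF hG
  refine ⟨‖ι F‖ * ‖ι G‖, fun t => ?_⟩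
  rw [hOS.integral_conj_comp_reflect_mul_comp_iterate hF hG t, hOS.integral_conj_comp_reflect hF,
    hOS.integral_eq_inner_vacuum hG]
  exact hm.norm_inner_pow_apply_sub_le (ι F) (ι G) t

end Proofs

end Literature.Probability.LatticeModels
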